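import Literature.Probability.RandomPlanarGeometry.LatticeSlitIncrements
import Literature.Probability.RandomPlanarGeometry.ChordalCapacityDivergence
import HarnessLib

/-!
# The capacity of the stem of a lattice slit vanishes with the mesh

Companion of `LatticeSlitIncrements.lean` (half-plane Loewner coordinates of a growing lattice
slit: `LatticeSlit.basePt / pastHull / capTime`, the stem `stemArc z₀` attaching the pulled-back
lattice path, which starts at the interior point `z₀ = φ⁻¹(δ a_δ)`, to the boundary point `0`).
Before the first lattice step the past of a walk of `Ω_δ` started at `a_δ` is the stem alone, and
its capacity time `t_∅ = hcap(Fill_ℍ(closure (stem z₀)))/2` is the time offset at which every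
Loewner description of the lattice curve through `φ` starts. This file PROVES that this offset
is `O(|z₀|²)` and hence tends to `0` with the mesh, uniformly in the walk:

* `hpFill_subset_closedBall` — the fill of a set inside `B̄(0, R)` stays inside `B̄(0, R)`
  (far points of `ℍ` lie in the unbounded component, `diff_closedBall_subset_unboundedComponent`);
* `hcapOf_le_of_subset_closedBall` — `hcap(K) ≤ 288 r²` for `K ∩ ℍ ⊆ B̄(x, r)` (Lawler (2005),
  (3.9): `hcap(A) ≤ rad(A)²`, in the tree's form `IsHydrodynamicMap.hcap_le`, transported to the
  total functional `hcapOf`);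
* `LatticeSlit.pastHull_subset_closedBall_of_nil`, `LatticeSlit.capTime_le_of_nil` — for a
  trivial walk (`η.Nil`, e.g. the past `γ[0, 0]`) at a site `a` with `δ a ∈ D`:
  `K_∅ ⊆ B̄(0, |z₀|)` (`stemArc_subset_closedBall`) and `t_∅ ≤ 144 |z₀|²`;
* `LatticeSlit.eventually_capTime_le_of_nil` — if `δ · a_δ → a = φ(0)` and `δ · a_δ ∈ D`
  eventually, then for every `ε > 0`, eventually (as `δ → 0⁺`) `t_∅ ≤ ε` for every trivial walk
  at `a_δ` (boundary continuity `φ⁻¹ → 0` at `a`,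
  `MarkedDomain.IsChordalUniformizing.tendsto_symm_nhds_zero`).

## References

* G. F. Lawler, *Conformally Invariant Processes in the Plane*, AMS (2005), §3.4 (3.9)
  (`hcap(A) ≤ rad(A)²`), §4.1 (capacity parametrisation `hcap(K_t) = 2t`). [Lawler2005]
* Ch. Pommerenke, *Boundary Behaviour of Conformal Maps* (1992), Thm. 2.6 (Carathéodory).
  [PommerenkeBBCM1992]
-/

noncomputable section

open Set Filter Topology Metric Bornology Complex
open UpperHalfPlane (upperHalfPlaneSet isOpen_upperHalfPlaneSet)
open Literature.Probability.LatticeModels (meshPoint discreteDomainGraph Site)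

namespace Literature.Probability.RandomPlanarGeometry

/-! ### Fills and capacities of sets in a disc -/

/-- **The fill of a set inside `B̄(0, R)` lies inside `B̄(0, R)`**: points of `ℍ` outside the
closed disc are in the unbounded component of `ℍ ∖ S` (`diff_closedBall_subset_unboundedComponent`),
and the disc is closed. [cite: LawlerSchrammWerner2003Restriction, §2 p. 8 (Fillings)] -/
theorem hpFill_subset_closedBall {S : Set ℂ} {R : ℝ} (hS : S ⊆ closedBall 0 R) :
    hpFill S ⊆ closedBall 0 R := by
  refine closure_minimal ?_ isClosed_closedBall
  rintro z ⟨hz, hzV⟩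
  by_contra hzR
  exact hzV (diff_closedBall_subset_unboundedComponent hS ⟨hz, hzR⟩)

/-- **`hcap(K) ≤ 288 r²` when `K ∩ ℍ ⊆ B̄(x, r)`** (Lawler (2005), (3.9): `hcap(A) ≤ rad(A)²`,
with the tree's constant), for the total functional `hcapOf` (computed with the chosen
hydrodynamic map, `IsHydrodynamicMap.hcap_le`; the junk value `0` without one).
[cite: Lawler2005, §3.4 (3.9)] -/
theorem hcapOf_le_of_subset_closedBall {K : Set ℂ} {x r : ℝ}
    (hK : K ∩ upperHalfPlaneSet ⊆ closedBall (x : ℂ) r) (hr : 0 < r) :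
    hcapOf K ≤ 288 * r ^ 2 := by
  by_cases h : HasHydroMap K
  · rw [hcapOf_of_hasHydroMap h]
    exact (isHydrodynamicMap_hydroEquiv h).hcap_le hK hr
  · rw [hcapOf_of_not h]
    positivity

/-! ### The past of a trivial walk is the stem -/

namespace LatticeSlit

variable {D : DobrushinDomain} {φ : ConformalEquiv upperHalfPlaneSet D.carrier} {δ : ℝ}
  {a w : Site 2}

/-- The polyline of a trivial walk is its base point. [folklore] -/
theorem range_toCurve_of_nil (η : (discreteDomainGraph D.carrier δ).Walk a w) (hη : η.Nil) :
    range (η.toCurve (meshPoint δ)) = {meshPoint δ a} := by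
  cases hη
  simp [SimpleGraph.Walk.toCurve, LatticeModels.polyline]

/-- The trace of a trivial walk at a site `a` with `δ a ∈ D` is the base point `z₀ = φ⁻¹(δ a)`.
[folklore] -/
theorem trace_of_nil (η : (discreteDomainGraph D.carrier δ).Walk a w) (hη : η.Nil)
    (ha : meshPoint δ a ∈ D.carrier) : trace φ η = {basePt φ δ a} := by
  rw [trace, range_toCurve_of_nil η hη, inter_eq_left.2 (singleton_subset_iff.2 ha),
    image_singleton]
  rfl

/-- **The past of a trivial walk is the closed stem**: `S_∅ = closure (stemArc z₀)` (the base
point `z₀` is on its own stem). [folklore] -/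
theorem pastSet_of_nil (η : (discreteDomainGraph D.carrier δ).Walk a w) (hη : η.Nil)
    (ha : meshPoint δ a ∈ D.carrier) : pastSet φ η = closure (stemArc (basePt φ δ a)) := by
  rw [pastSet, trace_of_nil η hη ha, union_eq_left.2 (singleton_subset_iff.2 (self_mem_stemArc _))]

/-- **The hull of a trivial walk lies in `B̄(0, |z₀|)`**, `z₀ = φ⁻¹(δ a) ∈ ℍ`: the stem lies in
that disc (`stemArc_subset_closedBall`), hence so do its closure and its fill
(`hpFill_subset_closedBall`). [cite: Lawler2005, §3.4 (3.9)] -/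
theorem pastHull_subset_closedBall_of_nil (η : (discreteDomainGraph D.carrier δ).Walk a w)
    (hη : η.Nil) (ha : meshPoint δ a ∈ D.carrier) :
    pastHull φ η ⊆ closedBall 0 ‖basePt φ δ a‖ := by
  have hz₀ : 0 < (basePt φ δ a).im := φ.symm_mapsTo ha
  rw [pastHull, pastSet_of_nil η hη ha]
  exact hpFill_subset_closedBall
    (closure_minimal (stemArc_subset_closedBall hz₀.le) isClosed_closedBall)

/-- **The capacity time of a trivial walk is at most `144 |z₀|²`** (`2 t_∅ = hcap(K_∅) ≤ 288 |z₀|²`,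
Lawler (2005), (3.9), since `K_∅ ⊆ B̄(0, |z₀|)`). [cite: Lawler2005, §3.4 (3.9)] -/
theorem capTime_le_of_nil (η : (discreteDomainGraph D.carrier δ).Walk a w) (hη : η.Nil)
    (ha : meshPoint δ a ∈ D.carrier) : capTime φ η ≤ 144 * ‖basePt φ δ a‖ ^ 2 := by
  have hz₀ : 0 < (basePt φ δ a).im := φ.symm_mapsTo ha
  have hnorm : 0 < ‖basePt φ δ a‖ := by
    refine norm_pos_iff.2 fun h ↦ ?_
    rw [h] at hz₀
    simp at hz₀
  have hsub : pastHull φ η ∩ upperHalfPlaneSet ⊆ closedBall (((0 : ℝ) : ℂ)) ‖basePt φ δ a‖ := by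
    rw [Complex.ofReal_zero]
    exact inter_subset_left.trans (pastHull_subset_closedBall_of_nil η hη ha)
  have h := hcapOf_le_of_subset_closedBall hsub hnorm
  rw [capTime]
  linarith

/-- The capacity time of a trivial walk at a site inside `D` is nonnegative. [cite: Lawler2005, §3.4 (3.8)] -/
theorem capTime_nonneg_of_nil (η : (discreteDomainGraph D.carrier δ).Walk a w) (hη : η.Nil)
    (ha : meshPoint δ a ∈ D.carrier) : 0 ≤ capTime φ η := by
  refine capTime_nonneg η ?_
  rw [range_toCurve_of_nil η hη]
  exact singleton_subset_iff.2 ha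

/-- **The stem capacity vanishes with the mesh, uniformly in the walk.** If `φ` is a chordal
uniformizing map of `(D; a, b)` and the lattice starting points satisfy `δ · a_δ → a` with
`δ · a_δ ∈ D` for all small `δ > 0`, then for every `ε > 0`, for all small `δ > 0`, every trivial
walk `η` of `Ω_δ` at `a_δ` (e.g. the past `γ[0, 0]` of any walk `γ` from `a_δ`) has capacity time
`t_η ≤ ε`: `t_η ≤ 144 |φ⁻¹(δ a_δ)|²` and `φ⁻¹ → 0` at `a`
(`MarkedDomain.IsChordalUniformizing.tendsto_symm_nhds_zero`). [cite: Lawler2005, §4.1 (capacity parametrisation) with §3.4 (3.9)] -/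
theorem eventually_capTime_le_of_nil (hφ : D.IsChordalUniformizing φ) {a : ℝ → Site 2}
    (ha : Tendsto (fun δ ↦ meshPoint δ (a δ)) (𝓝[>] (0 : ℝ)) (𝓝 (D.pt 0)))
    (haD : ∀ᶠ δ in 𝓝[>] (0 : ℝ), meshPoint δ (a δ) ∈ D.carrier) {ε : ℝ} (hε : 0 < ε) :
    ∀ᶠ δ in 𝓝[>] (0 : ℝ), ∀ (w : Site 2) (η : (discreteDomainGraph D.carrier δ).Walk (a δ) w),
      η.Nil → capTime φ η ≤ ε := by
  -- `φ⁻¹(δ a_δ) → 0`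
  have hwithin : Tendsto (fun δ ↦ meshPoint δ (a δ)) (𝓝[>] (0 : ℝ)) (𝓝[D.carrier] (D.pt 0)) :=
    tendsto_nhdsWithin_iff.2 ⟨ha, haD⟩
  have hz : Tendsto (fun δ ↦ basePt φ δ (a δ)) (𝓝[>] (0 : ℝ)) (𝓝 0) :=
    hφ.tendsto_symm_nhds_zero.comp hwithin
  have hsmall : ∀ᶠ δ in 𝓝[>] (0 : ℝ), ‖basePt φ δ (a δ)‖ < Real.sqrt (ε / 144) := by
    have h0 : 0 < Real.sqrt (ε / 144) := Real.sqrt_pos.2 (by positivity)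
    exact (tendsto_zero_iff_norm_tendsto_zero.1 hz).eventually (gt_mem_nhds h0)
  filter_upwards [hsmall, haD] with δ hδ hδD w η hη
  have hsq : ‖basePt φ δ (a δ)‖ ^ 2 < ε / 144 := by
    have h1 : ‖basePt φ δ (a δ)‖ ^ 2 < Real.sqrt (ε / 144) ^ 2 :=
      pow_lt_pow_left₀ hδ (norm_nonneg _) two_ne_zero
    rwa [Real.sq_sqrt (by positivity)] at h1
  have := capTime_le_of_nil (φ := φ) η hη hδD
  linarith

end LatticeSlit

end Literature.Probability.RandomPlanarGeometry

end
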